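import Summits.CriticalPhenomena.PercolationContinuityZ3.Theorems.PercNearOneGluingNoHeavyQuantConvAtoms
import Summits.CriticalPhenomena.PercolationContinuityZ3.Theorems.PercNearOneGluingNoHeavyQuantLawDecStrongDuality
import Mathlib.Analysis.Convex.KreinMilman
import Mathlib.Analysis.Convex.Caratheodory
import Mathlib.LinearAlgebra.AffineSpace.FiniteDimensional
import HarnessLib

/-!
# QUANT lane R8, T-DEC: `WindowAtomDecomposition` REDUCED TO ITS EXTREME POINTS — the window-DEC probability laws on `{0..M}`
# form a compact convex set (a polytope), so by Krein–Milman and Carathéodory every such law is a finite mixture of laws in the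
# closure of its extreme points; hence `WindowAtomDecomposition ⟸ WindowExtremeSmall` (every extreme point is a `SmallLaw`)

builds on p205010 (kernel theorem, internal audit signed; external expert review pending)

Statement + support file (`--supports stmt-CriticalPhenomena-4575`), QUANT lane seat prim-quant-census-2 (gen 57), rung R8 of
`run/shared/lean/prim/quant/LADDER.md`; memo `run/shared/lean/prim/quant/prim-quant-census-2-g57/WINDOW-ATOMS-G57.md`.  Two small
definitions (`vecLaw`, `windowSet`), one `@[conjecture]` definition (`WindowExtremeSmall`), theorems with standard axioms, no sorries.

WHY.  Census-2 g56 typed `LawDec.WindowAtomDecomposition` ("every window-DEC probability law is a finite mixture of SMALL window-DEC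
laws", `…QuantConvAtoms`) and the lead's `Quant.farTreeRow_of_three` makes it one of the three statements the R8 law level rests on
(README V279/V280).  Its natural proof (memo §2, this seat: a perturbation-budget argument over the kernel's corner run, verified exactly
on every extreme ray of the census) is a statement about EXTREME POINTS: a window-DEC law charging ≥ 3 lows or ≥ 3 absorbers of the
top layer admits a two-sided perturbation inside the window polytope.  This file is the convex-geometry half, once and for all:

* `LawDec.vecLaw M v` — the law on `ℕ` carried by a coordinate vector `v : Fin (M+1) → ℝ` (zero above `M`).
* `LawDec.windowSet x T M j w ⊆ (Fin (M+1) → ℝ)` — the WINDOW POLYTOPE: `v ≥ 0`, `Σ v = 1`, `vecLaw M v` DEC(J) at target `T`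
  for every layer `J ≤ j` with `j ≤ J + w` (the hypothesis block of `WindowAtomDecomposition` / `ConvClosedT`).
* `LawDec.convex_windowSet` (`decAtT_mixture`), `LawDec.isClosed_windowSet` (strong duality `decAtT_iff_prices`, census-2 g54:
  on the simplex DEC(J) is an intersection of closed half-spaces indexed by price systems), `LawDec.isCompact_windowSet`.
* `IsCompact.convexHull_of_finiteDimensional` — in a finite-dimensional real normed space the convex hull of a compact set is
  compact (Carathéodory: it is the continuous image of `stdSimplex × s^{d+1}`).  Mathlib has the finite-set case
  (`Set.Finite.isCompact_convexHull`) and Krein–Milman with a closure (`closure_convexHull_extremePoints`); this lemma removes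
  the closure in finite dimension.
* `LawDec.WindowExtremeSmall` (`@[conjecture]`, the target the memo's proof establishes on paper): for `0 < x < 1` every extreme
  point of the window polytope is a `SmallLaw` at `(T, j)` (≤ 2 lows of layer `j`, ≤ 2 absorbers).
* **`LawDec.windowAtomDecomposition_of_extremeSmall : WindowExtremeSmall → WindowAtomDecomposition`.**  Proof: the polytope `P`
  is compact and convex; `K :=` closure of its extreme points is compact, `⊆ P`, and `⊆` the (closed, finite union of coordinate
  subspaces) set of small vectors; `P = closure (convexHull ext P) ⊆ convexHull K` since the latter is compact;
  `eq_pos_convex_span_of_mem_convexHull` gives the finite mixture, and every `z ∈ K` is a window-DEC small probability law.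
  Hence also `ConvClosedT ⟸ WindowExtremeSmall ∧ ConvClosedTResidue` (`convClosedT_of_extremeSmall_residue`).

EVIDENCE for `WindowExtremeSmall`: the g56 atlas (11 060 278 extreme rays, supports ≤ 4, kit j148044) + this seat's exact anatomy (memo §3).
Krein–Milman / Carathéodory are Mathlib; nothing here is cited as a published result.  [this work]; the gluing rows served
[cite: KozmaNitzan2024, Conjecture 3 (p. 15)]; product measure [cite: Grimmett1999, §1.3 p. 10].
-/

noncomputable section

open scoped BigOperators

/-! ### Convex hulls of compact sets in finite dimension -/

/-- **In a finite-dimensional real normed space the convex hull of a compact set is compact** (Carathéodory: every point of the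
hull is a convex combination of at most `d + 1` points, so the hull is the continuous image of the compact set
`stdSimplex ℝ (Fin (d+1)) × s^{Fin (d+1)}`). [folklore] -/
theorem IsCompact.convexHull_of_finiteDimensional {E : Type*} [NormedAddCommGroup E] [NormedSpace ℝ E]
    [FiniteDimensional ℝ E] {s : Set E} (hs : IsCompact s) : IsCompact (convexHull ℝ s) := by
  classical
  rcases s.eq_empty_or_nonempty with rfl | ⟨x₀, hx₀⟩
  · rw [convexHull_empty]; exact isCompact_empty
  set d := Module.finrank ℝ E with hd
  let A : Set ((Fin (d + 1) → ℝ) × (Fin (d + 1) → E)) :=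
    stdSimplex ℝ (Fin (d + 1)) ×ˢ Set.pi Set.univ (fun _ => s)
  have hA : IsCompact A := (isCompact_stdSimplex ℝ (Fin (d + 1))).prod (isCompact_univ_pi fun _ => hs)
  let φ : (Fin (d + 1) → ℝ) × (Fin (d + 1) → E) → E := fun p => ∑ i, p.1 i • p.2 i
  have hφ : Continuous φ := by
    refine continuous_finsetSum _ fun i _ => ?_
    exact ((continuous_apply i).comp continuous_fst).smul ((continuous_apply i).comp continuous_snd)
  suffices h : convexHull ℝ s = φ '' A by rw [h]; exact hA.image hφ
  apply Set.Subset.antisymm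
  · intro y hy
    obtain ⟨ι, _inst, z, w, hz, hai, hwpos, hw1, hwy⟩ := eq_pos_convex_span_of_mem_convexHull hy
    have hcard : Fintype.card ι ≤ d + 1 :=
      hai.card_le_finrank_succ.trans (Nat.add_le_add_right (Submodule.finrank_le _) 1)
    let e : ι ↪ Fin (d + 1) := (Fintype.equivFin ι).toEmbedding.trans (Fin.castLEEmb hcard)
    have he : Function.Injective e := e.injective
    let w' : Fin (d + 1) → ℝ := Function.extend e w 0
    let z' : Fin (d + 1) → E := Function.extend e z (fun _ => x₀)
    -- values on and off the range of `e`
    have hw'on : ∀ i, w' (e i) = w i := fun i => he.extend_apply w 0 i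
    have hz'on : ∀ i, z' (e i) = z i := fun i => he.extend_apply z _ i
    have hw'off : ∀ k, (¬ ∃ i, e i = k) → w' k = 0 := fun k hk => by
      show Function.extend e w 0 k = 0
      rw [Function.extend_apply' _ _ _ hk]; rfl
    -- the padded sum equals the original one
    have hsum : ∀ (g : ι → E) (g' : Fin (d + 1) → E), (∀ i, g' (e i) = g i) → (∀ k, (¬ ∃ i, e i = k) → g' k = 0) →
        ∑ k, g' k = ∑ i, g i := by
      intro g g' hon hoff
      rw [← Finset.sum_subset (Finset.subset_univ (Finset.univ.map e)), Finset.sum_map]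
      · exact Finset.sum_congr rfl fun i _ => hon i
      · intro k _ hk
        refine hoff k fun ⟨i, hi⟩ => hk ?_
        exact Finset.mem_map.2 ⟨i, Finset.mem_univ _, hi⟩
    have hsumR : ∀ (g : ι → ℝ) (g' : Fin (d + 1) → ℝ), (∀ i, g' (e i) = g i) → (∀ k, (¬ ∃ i, e i = k) → g' k = 0) →
        ∑ k, g' k = ∑ i, g i := by
      intro g g' hon hoff
      rw [← Finset.sum_subset (Finset.subset_univ (Finset.univ.map e)), Finset.sum_map]
      · exact Finset.sum_congr rfl fun i _ => hon i
      · intro k _ hk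
        refine hoff k fun ⟨i, hi⟩ => hk ?_
        exact Finset.mem_map.2 ⟨i, Finset.mem_univ _, hi⟩
    refine ⟨(w', z'), ⟨⟨fun k => ?_, ?_⟩, fun k _ => ?_⟩, ?_⟩
    · show 0 ≤ w' k
      by_cases hk : ∃ i, e i = k
      · obtain ⟨i, rfl⟩ := hk; rw [hw'on]; exact (hwpos i).le
      · rw [hw'off k hk]
    · show ∑ k, w' k = 1
      rw [hsumR w w' hw'on hw'off]; exact hw1
    · by_cases hk : ∃ i, e i = k
      · obtain ⟨i, rfl⟩ := hk
        show z' (e i) ∈ s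
        rw [hz'on]; exact hz ⟨i, rfl⟩
      · show Function.extend e z (fun _ => x₀) k ∈ s
        rw [Function.extend_apply' _ _ _ hk]; exact hx₀
    · show ∑ k, w' k • z' k = y
      rw [← hwy]
      refine hsum (fun i => w i • z i) (fun k => w' k • z' k) (fun i => by rw [hw'on, hz'on]) (fun k hk => ?_)
      rw [hw'off k hk, zero_smul]
  · rintro _ ⟨⟨w, z⟩, ⟨hw, hz⟩, rfl⟩
    exact (convex_convexHull ℝ s).sum_mem (fun i _ => hw.1 i) hw.2
      (fun i _ => subset_convexHull ℝ s (hz i (Set.mem_univ _)))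

namespace Summit.CriticalPhenomena.PercolationContinuityZ3.Theorems

namespace Quant

open Finset

namespace LawDec

/-! ### Laws as coordinate vectors; the window polytope -/

/-- **the law on `ℕ` carried by a coordinate vector** `v : Fin (M+1) → ℝ`: `v ⟨h, _⟩` for `h ≤ M`, `0` above `M`. [this work] -/
def vecLaw (M : ℕ) (v : Fin (M + 1) → ℝ) : ℕ → ℝ :=
  fun h => if hh : h < M + 1 then v ⟨h, hh⟩ else 0

/-- `vecLaw` below the top. [this work] -/
theorem vecLaw_apply_of_lt {M : ℕ} (v : Fin (M + 1) → ℝ) {h : ℕ} (hh : h < M + 1) :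
    vecLaw M v h = v ⟨h, hh⟩ := by
  simp only [vecLaw, dif_pos hh]

/-- `vecLaw` vanishes above the top. [this work] -/
theorem vecLaw_apply_of_gt {M : ℕ} (v : Fin (M + 1) → ℝ) {h : ℕ} (hh : M < h) : vecLaw M v h = 0 := by
  simp only [vecLaw, dif_neg (not_lt.2 (Nat.succ_le_of_lt hh))]

/-- `vecLaw` at a `Fin` index. [this work] -/
theorem vecLaw_fin {M : ℕ} (v : Fin (M + 1) → ℝ) (i : Fin (M + 1)) : vecLaw M v i = v i := by
  rw [vecLaw_apply_of_lt v i.isLt]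

/-- `vecLaw` is linear. [this work] -/
theorem vecLaw_add_smul {M : ℕ} (a b : ℝ) (v w : Fin (M + 1) → ℝ) (h : ℕ) :
    vecLaw M (a • v + b • w) h = a * vecLaw M v h + b * vecLaw M w h := by
  by_cases hh : h < M + 1
  · simp only [vecLaw, dif_pos hh, Pi.add_apply, Pi.smul_apply, smul_eq_mul]
  · simp only [vecLaw, dif_neg hh, mul_zero, add_zero]

/-- the mass of `vecLaw M v` on `{0..M}` is `Σ v`. [this work] -/
theorem sum_range_vecLaw {M : ℕ} (v : Fin (M + 1) → ℝ) :
    ∑ h ∈ Finset.range (M + 1), vecLaw M v h = ∑ i, v i := by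
  rw [← Fin.sum_univ_eq_sum_range]
  exact Finset.sum_congr rfl fun i _ => vecLaw_fin v i

/-- a law vanishing above `M` is the `vecLaw` of its restriction. [this work] -/
theorem vecLaw_restrict {M : ℕ} (μ : ℕ → ℝ) (hμM : ∀ h, M < h → μ h = 0) :
    vecLaw M (fun i : Fin (M + 1) => μ i) = μ := by
  funext h
  by_cases hh : h < M + 1
  · rw [vecLaw_apply_of_lt _ hh]
  · rw [vecLaw, dif_neg hh, hμM h (not_lt.1 (fun hle => hh (Nat.lt_succ_of_le (Nat.lt_succ_iff.1 hle))))]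

/-- `v ↦ vecLaw M v h` is continuous. [this work] -/
theorem continuous_vecLaw (M h : ℕ) : Continuous fun v : Fin (M + 1) → ℝ => vecLaw M v h := by
  by_cases hh : h < M + 1
  · simp only [vecLaw, dif_pos hh]; exact continuous_apply _
  · simp only [vecLaw, dif_neg hh]; exact continuous_const

/-- **THE WINDOW POLYTOPE** at floor `x`, target `T`, top `M`, layer `j`, width `w`: probability vectors `v` on `{0..M}` whose
law is DEC(J) at target `T` for every layer `J ≤ j` with `j ≤ J + w` — the hypothesis block of `WindowAtomDecomposition`. [this work] -/
def windowSet (x T : ℝ) (M j w : ℕ) : Set (Fin (M + 1) → ℝ) :=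
  {v | (∀ i, 0 ≤ v i) ∧ ∑ i, v i = 1 ∧ ∀ J, J ≤ j → j ≤ J + w → DECAtT x T J M (vecLaw M v)}

/-- the window polytope lies in the standard simplex. [this work] -/
theorem windowSet_subset_stdSimplex (x T : ℝ) (M j w : ℕ) :
    windowSet x T M j w ⊆ stdSimplex ℝ (Fin (M + 1)) := fun _ hv => ⟨hv.1, hv.2.1⟩

/-- **the window polytope is convex** (`decAtT_mixture` at every layer). [this work] -/
theorem convex_windowSet (x T : ℝ) (M j w : ℕ) : Convex ℝ (windowSet x T M j w) := by
  intro v hv v' hv' a b ha hb hab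
  refine ⟨fun i => ?_, ?_, fun J hJ hJw => ?_⟩
  · simp only [Pi.add_apply, Pi.smul_apply, smul_eq_mul]
    exact add_nonneg (mul_nonneg ha (hv.1 i)) (mul_nonneg hb (hv'.1 i))
  · simp only [Pi.add_apply, Pi.smul_apply, smul_eq_mul, Finset.sum_add_distrib, ← Finset.mul_sum, hv.2.1, hv'.2.1,
      mul_one, hab]
  · have hb' : b = 1 - a := by linarith
    have e : vecLaw M (a • v + b • v') = fun h => a * vecLaw M v h + (1 - a) * vecLaw M v' h := by
      funext h; rw [vecLaw_add_smul, hb']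
    rw [e]
    exact decAtT_mixture a ha (by linarith) (hv.2.2 J hJ hJw) (hv'.2.2 J hJ hJw)

/-- **the window polytope is closed**: on the simplex, DEC(J) at target `T` is equivalent to the family of weak-duality
inequalities over all price systems (`decAtT_iff_prices`, `0 < x < 1`), each a closed condition. [this work] -/
theorem isClosed_windowSet (x T : ℝ) (M j w : ℕ) (hx0 : 0 < x) (hx1 : x < 1) : IsClosed (windowSet x T M j w) := by
  -- the price description
  set C : Set (Fin (M + 1) → ℝ) := {v | ∀ J, J ≤ j → j ≤ J + w → ∀ α β : ℕ → ℝ, (∀ h, 0 ≤ β h) →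
      (∀ l h, l ≤ J → 2 * (l : ℝ) < T → h ≤ M → (J + 1 ≤ h ∨ T < (l : ℝ) + h) → α l ≤ usage x T J l h * β h) →
      ∑ l ∈ Finset.range (J + 1), (if 2 * (l : ℝ) < T then α l * vecLaw M v l else 0)
        ≤ ∑ h ∈ Finset.range (M + 1), (if h ≤ J ∧ 2 * (h : ℝ) < T then 0 else β h * vecLaw M v h)} with hC
  have hCcl : IsClosed C := by
    have e : C = ⋂ (J : ℕ) (_ : J ≤ j) (_ : j ≤ J + w) (α : ℕ → ℝ) (β : ℕ → ℝ) (_ : ∀ h, 0 ≤ β h)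
        (_ : ∀ l h, l ≤ J → 2 * (l : ℝ) < T → h ≤ M → (J + 1 ≤ h ∨ T < (l : ℝ) + h) → α l ≤ usage x T J l h * β h),
        {v : Fin (M + 1) → ℝ | ∑ l ∈ Finset.range (J + 1), (if 2 * (l : ℝ) < T then α l * vecLaw M v l else 0)
          ≤ ∑ h ∈ Finset.range (M + 1), (if h ≤ J ∧ 2 * (h : ℝ) < T then 0 else β h * vecLaw M v h)} := by
      ext v; simp only [hC, Set.mem_setOf_eq, Set.mem_iInter]
    rw [e]
    refine isClosed_iInter fun J => isClosed_iInter fun _ => isClosed_iInter fun _ => isClosed_iInter fun α =>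
      isClosed_iInter fun β => isClosed_iInter fun _ => isClosed_iInter fun _ => isClosed_le ?_ ?_
    · refine continuous_finsetSum _ fun l _ => ?_
      split_ifs
      · exact continuous_const.mul (continuous_vecLaw M l)
      · exact continuous_const
    · refine continuous_finsetSum _ fun h _ => ?_
      split_ifs
      · exact continuous_const
      · exact continuous_const.mul (continuous_vecLaw M h)
  have e : windowSet x T M j w = stdSimplex ℝ (Fin (M + 1)) ∩ C := by
    ext v
    constructor
    · intro hv
      refine ⟨⟨hv.1, hv.2.1⟩, fun J hJ hJw => ?_⟩
      have h1 : ∑ h ∈ Finset.range (M + 1), vecLaw M v h = 1 := by rw [sum_range_vecLaw, hv.2.1]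
      exact (decAtT_iff_prices x T J M (vecLaw M v) hx0 hx1 (fun h hh => vecLaw_apply_of_gt v hh) h1).1 (hv.2.2 J hJ hJw)
    · rintro ⟨hv, hvC⟩
      refine ⟨hv.1, hv.2, fun J hJ hJw => ?_⟩
      have h1 : ∑ h ∈ Finset.range (M + 1), vecLaw M v h = 1 := by rw [sum_range_vecLaw, hv.2]
      exact (decAtT_iff_prices x T J M (vecLaw M v) hx0 hx1 (fun h hh => vecLaw_apply_of_gt v hh) h1).2 (hvC J hJ hJw)
  rw [e]
  exact (isCompact_stdSimplex ℝ (Fin (M + 1))).isClosed.inter hCcl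

/-- **the window polytope is compact.** [this work] -/
theorem isCompact_windowSet (x T : ℝ) (M j w : ℕ) (hx0 : 0 < x) (hx1 : x < 1) : IsCompact (windowSet x T M j w) :=
  (isCompact_stdSimplex ℝ (Fin (M + 1))).of_isClosed_subset (isClosed_windowSet x T M j w hx0 hx1)
    (windowSet_subset_stdSimplex x T M j w)

/-! ### Small vectors form a closed set -/

/-- the coordinate form of `SmallLaw`: the support of `v` lies in `{l, l′, h, h′}` with `h, h′` absorbers of layer `j`.
It is a finite union (over `l, l′, h, h′ : Fin (M+1)`) of coordinate subspaces, hence closed. [this work] -/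
theorem isClosed_smallVec (T : ℝ) (M j : ℕ) :
    IsClosed {v : Fin (M + 1) → ℝ | ∃ l l' h h' : Fin (M + 1), (T ≤ 2 * ((h : ℕ) : ℝ) ∨ j + 1 ≤ (h : ℕ)) ∧
      (T ≤ 2 * ((h' : ℕ) : ℝ) ∨ j + 1 ≤ (h' : ℕ)) ∧ ∀ k : Fin (M + 1), v k ≠ 0 → (k = l ∨ k = l' ∨ k = h ∨ k = h')} := by
  have e : {v : Fin (M + 1) → ℝ | ∃ l l' h h' : Fin (M + 1), (T ≤ 2 * ((h : ℕ) : ℝ) ∨ j + 1 ≤ (h : ℕ)) ∧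
      (T ≤ 2 * ((h' : ℕ) : ℝ) ∨ j + 1 ≤ (h' : ℕ)) ∧ ∀ k : Fin (M + 1), v k ≠ 0 → (k = l ∨ k = l' ∨ k = h ∨ k = h')} =
      ⋃ (l : Fin (M + 1)) (l' : Fin (M + 1)) (h : Fin (M + 1)) (h' : Fin (M + 1)),
        {v | (T ≤ 2 * ((h : ℕ) : ℝ) ∨ j + 1 ≤ (h : ℕ)) ∧ (T ≤ 2 * ((h' : ℕ) : ℝ) ∨ j + 1 ≤ (h' : ℕ)) ∧
          ∀ k : Fin (M + 1), ¬ (k = l ∨ k = l' ∨ k = h ∨ k = h') → v k = 0} := by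
    ext v
    simp only [Set.mem_setOf_eq, Set.mem_iUnion, ne_eq]
    constructor
    · rintro ⟨l, l', h, h', hh, hh', hk⟩
      exact ⟨l, l', h, h', hh, hh', fun k hk' => by_contra fun hne => hk' (hk k hne)⟩
    · rintro ⟨l, l', h, h', hh, hh', hk⟩
      exact ⟨l, l', h, h', hh, hh', fun k hk' => by_contra fun hne => hk' (hk k hne)⟩
  rw [e]
  refine isClosed_iUnion_of_finite fun l => isClosed_iUnion_of_finite fun l' => isClosed_iUnion_of_finite fun h =>
    isClosed_iUnion_of_finite fun h' => ?_
  have e2 : {v : Fin (M + 1) → ℝ | (T ≤ 2 * ((h : ℕ) : ℝ) ∨ j + 1 ≤ (h : ℕ)) ∧ (T ≤ 2 * ((h' : ℕ) : ℝ) ∨ j + 1 ≤ (h' : ℕ)) ∧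
      ∀ k : Fin (M + 1), ¬ (k = l ∨ k = l' ∨ k = h ∨ k = h') → v k = 0} =
      {v | (T ≤ 2 * ((h : ℕ) : ℝ) ∨ j + 1 ≤ (h : ℕ)) ∧ (T ≤ 2 * ((h' : ℕ) : ℝ) ∨ j + 1 ≤ (h' : ℕ))} ∩
        ⋂ (k : Fin (M + 1)) (_ : ¬ (k = l ∨ k = l' ∨ k = h ∨ k = h')), {v | v k = 0} := by
    ext v; simp only [Set.mem_setOf_eq, Set.mem_inter_iff, Set.mem_iInter]; tauto
  rw [e2]
  refine IsClosed.inter ?_ (isClosed_iInter fun k => isClosed_iInter fun _ => isClosed_eq (continuous_apply k) continuous_const)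
  by_cases hp : (T ≤ 2 * ((h : ℕ) : ℝ) ∨ j + 1 ≤ (h : ℕ)) ∧ (T ≤ 2 * ((h' : ℕ) : ℝ) ∨ j + 1 ≤ (h' : ℕ))
  · have : {v : Fin (M + 1) → ℝ | (T ≤ 2 * ((h : ℕ) : ℝ) ∨ j + 1 ≤ (h : ℕ)) ∧
        (T ≤ 2 * ((h' : ℕ) : ℝ) ∨ j + 1 ≤ (h' : ℕ))} = Set.univ := Set.eq_univ_of_forall fun _ => hp
    rw [this]; exact isClosed_univ
  · have : {v : Fin (M + 1) → ℝ | (T ≤ 2 * ((h : ℕ) : ℝ) ∨ j + 1 ≤ (h : ℕ)) ∧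
        (T ≤ 2 * ((h' : ℕ) : ℝ) ∨ j + 1 ≤ (h' : ℕ))} = ∅ := Set.eq_empty_of_forall_notMem fun _ hv => hp hv
    rw [this]; exact isClosed_empty

/-- from `SmallLaw` of the carried law to the coordinate form (a position `> M` named by `SmallLaw` carries no mass and is
replaced by an absorber). [this work] -/
theorem smallVec_of_smallLaw {T : ℝ} {M j : ℕ} {v : Fin (M + 1) → ℝ} (hs : SmallLaw T j M (vecLaw M v)) :
    ∃ l l' h h' : Fin (M + 1), (T ≤ 2 * ((h : ℕ) : ℝ) ∨ j + 1 ≤ (h : ℕ)) ∧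
      (T ≤ 2 * ((h' : ℕ) : ℝ) ∨ j + 1 ≤ (h' : ℕ)) ∧ ∀ k : Fin (M + 1), v k ≠ 0 → (k = l ∨ k = l' ∨ k = h ∨ k = h') := by
  obtain ⟨l, l', h, h', hhM, hh'M, hh, hh', hk⟩ := hs
  let H : Fin (M + 1) := ⟨h, Nat.lt_succ_of_le hhM⟩
  let H' : Fin (M + 1) := ⟨h', Nat.lt_succ_of_le hh'M⟩
  -- a named low above `M` is replaced by the absorber `H`
  let L : Fin (M + 1) := if hl : l < M + 1 then ⟨l, hl⟩ else H
  let L' : Fin (M + 1) := if hl : l' < M + 1 then ⟨l', hl⟩ else H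
  refine ⟨L, L', H, H', hh, hh', fun k hk0 => ?_⟩
  have hk' : vecLaw M v k ≠ 0 := by rwa [vecLaw_fin]
  rcases hk k hk' with e | e | e | e
  · left
    have hl : l < M + 1 := e ▸ k.isLt
    apply Fin.ext; simp only [L, dif_pos hl]; exact e
  · right; left
    have hl : l' < M + 1 := e ▸ k.isLt
    apply Fin.ext; simp only [L', dif_pos hl]; exact e
  · right; right; left; exact Fin.ext e
  · right; right; right; exact Fin.ext e

/-- from the coordinate form back to `SmallLaw` of the carried law. [this work] -/
theorem smallLaw_of_smallVec {T : ℝ} {M j : ℕ} {v : Fin (M + 1) → ℝ}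
    (hs : ∃ l l' h h' : Fin (M + 1), (T ≤ 2 * ((h : ℕ) : ℝ) ∨ j + 1 ≤ (h : ℕ)) ∧
      (T ≤ 2 * ((h' : ℕ) : ℝ) ∨ j + 1 ≤ (h' : ℕ)) ∧ ∀ k : Fin (M + 1), v k ≠ 0 → (k = l ∨ k = l' ∨ k = h ∨ k = h')) :
    SmallLaw T j M (vecLaw M v) := by
  obtain ⟨l, l', h, h', hh, hh', hk⟩ := hs
  refine ⟨l, l', h, h', Nat.lt_succ_iff.1 h.isLt, Nat.lt_succ_iff.1 h'.isLt, hh, hh', fun k hk0 => ?_⟩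
  by_cases hkM : k < M + 1
  · rw [vecLaw_apply_of_lt v hkM] at hk0
    rcases hk ⟨k, hkM⟩ hk0 with e | e | e | e
    · exact Or.inl (congrArg Fin.val e)
    · exact Or.inr (Or.inl (congrArg Fin.val e))
    · exact Or.inr (Or.inr (Or.inl (congrArg Fin.val e)))
    · exact Or.inr (Or.inr (Or.inr (congrArg Fin.val e)))
  · exact absurd (by rw [vecLaw, dif_neg hkM]) hk0

/-! ### The conjecture on extreme points and the reduction -/

/-- **CONJECTURE — EXTREME POINTS OF THE WINDOW POLYTOPE ARE SMALL (census-2 g57).**  For a floor `0 < x < 1`, a target `T`, a top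
`M`, a layer `j` and a width `w`, every EXTREME POINT of `windowSet x T M j w` (window-DEC probability vectors on `{0..M}`) carries a
`SmallLaw` at `(T, j)`: at most two lows of layer `j` and at most two absorbers.  Equivalent to census-2 g56's atlas statement
(extreme rays of the window cone have ≤ 2 + 2 atoms); implies `WindowAtomDecomposition` (`windowAtomDecomposition_of_extremeSmall`).
PROOF ON PAPER (memo WINDOW-ATOMS-G57 §2, exact verification §3): layers below a low of the support are idle; by the corner theorem
(`cornerTheorem_holds`) the layer with `n` absorbers of the support as mids is feasible iff `Φ(n) = Σ_{k>n} μ_k − x/(1−x)·leftover_n ≥ 0`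
for the top layer's corner run truncated at `n`; segment bumps `e_l + usage(l,h)·e_h` over corner segments, points of unfull / dead /
giant absorbers and of leftover lows are two-sided perturbations at every window layer modulo one linear constraint per tight layer;
the constraints are nested tail sums, so an extreme point has (number of parameters) ≤ 1 + (number of non-trivial blocks between
consecutive tight layers); every block is zero-sum in `μ_k − x/(1−x)·W_k` and therefore holds ≥ 2 parameters — whence at most one
tight giant layer (the all-giant one), nothing below it, and ≤ 2 columns / ≤ 2 segments: ≤ 2 lows, ≤ 2 absorbers.  EVIDENCE: g56 atlas
kit j148044 (11 060 278 extreme rays, supports `{1,2,3,4}`); this seat's anatomy (parameter budget = 1 at all 8 001 rays with lows,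
`M ≤ 4`; family ⊆ tangent space, 0 / 13 500). [this work] [status: open] -/
@[conjecture] def WindowExtremeSmall : Prop :=
  ∀ (x T : ℝ) (M j w : ℕ) (v : Fin (M + 1) → ℝ), 0 < x → x < 1 →
    v ∈ (windowSet x T M j w).extremePoints ℝ → SmallLaw T j M (vecLaw M v)

/-- **`WindowAtomDecomposition` FROM ITS EXTREME POINTS** (Krein–Milman + Carathéodory on the window polytope). [this work] -/
theorem windowAtomDecomposition_of_extremeSmall (hE : WindowExtremeSmall) : WindowAtomDecomposition := by
  intro x T M j w μ hx0 hx1 hμ0 hμM hμ1 hwin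
  classical
  -- the coordinate vector of `μ` lies in the window polytope
  set P := windowSet x T M j w with hPdef
  let v : Fin (M + 1) → ℝ := fun i => μ i
  have hvμ : vecLaw M v = μ := vecLaw_restrict μ hμM
  have hv1 : ∑ i, v i = 1 := by
    have := sum_range_vecLaw v; rw [hvμ, hμ1] at this; exact this.symm
  have hvP : v ∈ P := ⟨fun i => hμ0 i, hv1, fun J hJ hJw => by rw [hvμ]; exact hwin J hJ hJw⟩
  have hPc : IsCompact P := isCompact_windowSet x T M j w hx0 hx1
  have hPconv : Convex ℝ P := convex_windowSet x T M j w
  -- K := closure of the extreme points: compact, inside P, small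
  set S : Set (Fin (M + 1) → ℝ) := {v | ∃ l l' h h' : Fin (M + 1), (T ≤ 2 * ((h : ℕ) : ℝ) ∨ j + 1 ≤ (h : ℕ)) ∧
      (T ≤ 2 * ((h' : ℕ) : ℝ) ∨ j + 1 ≤ (h' : ℕ)) ∧ ∀ k : Fin (M + 1), v k ≠ 0 → (k = l ∨ k = l' ∨ k = h ∨ k = h')} with hS
  set K := closure (P.extremePoints ℝ) with hK
  have hKP : K ⊆ P := closure_minimal extremePoints_subset hPc.isClosed
  have hKS : K ⊆ S :=
    closure_minimal (fun z hz => smallVec_of_smallLaw (hE x T M j w z hx0 hx1 hz)) (isClosed_smallVec T M j)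
  have hKc : IsCompact K := hPc.of_isClosed_subset isClosed_closure hKP
  -- v ∈ convexHull K
  have hvK : v ∈ convexHull ℝ K := by
    have h1 : v ∈ closure (convexHull ℝ (P.extremePoints ℝ)) := by
      rw [closure_convexHull_extremePoints hPc hPconv]; exact hvP
    exact closure_minimal (convexHull_mono subset_closure) hKc.convexHull_of_finiteDimensional.isClosed h1
  -- a finite positive mixture of points of K
  obtain ⟨ι, hι, z, wt, hz, -, hwpos, hw1, hwv⟩ := eq_pos_convex_span_of_mem_convexHull hvK
  refine ⟨ι, hι, wt, fun i => vecLaw M (z i), fun i => (hwpos i).le, hw1, fun h => ?_, fun i _ => ?_⟩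
  · -- the mixture identity, coordinate by coordinate
    show μ h = ∑ i, wt i * vecLaw M (z i) h
    by_cases hh : h < M + 1
    · have e1 := congrFun hwv ⟨h, hh⟩
      simp only [Finset.sum_apply, Pi.smul_apply, smul_eq_mul] at e1
      rw [← hvμ, vecLaw_apply_of_lt _ hh, ← e1]
      exact Finset.sum_congr rfl fun i _ => by rw [vecLaw_apply_of_lt _ hh]
    · rw [hμM h (not_lt.1 fun hle => hh (Nat.lt_succ_of_le (Nat.lt_succ_iff.1 hle)))]
      symm
      exact Finset.sum_eq_zero fun i _ => by rw [vecLaw, dif_neg hh, mul_zero]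
  · -- every charged component is a window-DEC small probability law
    have hzi : z i ∈ K := hz ⟨i, rfl⟩
    obtain ⟨hnn, hsum, hdec⟩ := hKP hzi
    refine ⟨fun h => ?_, fun h hh => vecLaw_apply_of_gt _ hh,
      by show ∑ h ∈ Finset.range (M + 1), vecLaw M (z i) h = 1; rw [sum_range_vecLaw, hsum],
      smallLaw_of_smallVec (hKS hzi), hdec⟩
    show 0 ≤ vecLaw M (z i) h
    by_cases hh : h < M + 1
    · rw [vecLaw_apply_of_lt _ hh]; exact hnn _
    · rw [vecLaw, dif_neg hh]

/-- **`ConvClosedT` ⟸ the extreme-point statement ∧ the two-sided residue** (with census-2 g56's `convClosedT_of_atoms_residue`).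
[this work] -/
theorem convClosedT_of_extremeSmall_residue (hE : WindowExtremeSmall) (hR : ConvClosedTResidue) : ConvClosedT :=
  convClosedT_of_atoms_residue (windowAtomDecomposition_of_extremeSmall hE) hR

end LawDec

end Quant

end Summit.CriticalPhenomena.PercolationContinuityZ3.Theorems
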